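import Mathlib
import Summits.KontsevichZagierPeriods.Zeta5Search.CasoratianLawGoodClasses
import Summits.KontsevichZagierPeriods.Zeta5Search.MixedPairs
import HarnessLib

/-!
# ζ(5) search — (CV) in the window REDUCES to the two block laws `MultiBlockLaw` + `MixedPairLaw`

Cell `pub-zeta5` (HONEST FRAMING: systematic search; no irrationality claim unless certified), typer seat
generation 9.  The `𝒦`-bracket `B = 𝒦(b⁺)V(b) − 𝒦(b)V(b⁺)` of `casoratian_split` is the double sum `Σ_x Σ_y B_xy` over residue classes;
its single-pole ROWS carry `1 − N_p` (`singleRowLaw_holds`, typer g9), its MIXED pairs (multipole `x`, single-pole `y`) are the subject of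
gen-2 g9's `MixedPairLaw` (= `MixedPairBoundLevel` (observed) + `mixedPairTermwise_holds`), and its multipole BLOCK is gen-2 g8's `MultiBlockLaw`
(observed).  This file proves the reduction

* `casoratianValuationLaw_of_blockLaws : MultiBlockLaw → MixedPairLaw → CasoratianValuationLaw`

(the `Ω`-bracket and the primes `p > b₀` are handled unconditionally: `omegaRes_eq_zero`, THEOREM V, `casoratianLaw_of_goodClasses`).  So (CV) at every window
prime now rests on exactly two OBSERVED digit statements about multipole classes.  `p`-adic valuations of rationals; nothing about irrationality.
-/

noncomputable section

open Finset

namespace Summit.KontsevichZagierPeriods.Zeta5Search.ClusterValuation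

open Summit.KontsevichZagierPeriods.Zeta5Search.DualSeries (InBox)
open Summit.KontsevichZagierPeriods.Zeta5Search.WedgeDictionary (coeffV dOf)
open Summit.KontsevichZagierPeriods.Zeta5Search.CasoratianValuation (InPolytope pairFloors refund shift casoratian CasoratianValuationLaw)
open Summit.KontsevichZagierPeriods.Zeta5Search.PadicSeries

variable {p : ℕ} [hp : Fact p.Prime]

/-- **The `𝒦`-bracket from the block laws** (`p ≤ b₀`): `‖𝒦(b⁺)V(b) − 𝒦(b)V(b⁺)‖ ≤ p^{−(refund − N_p)}`. -/
theorem kBracket_bound_of_blockLaws (hM : MultiBlockLaw) (hX : MixedPairLaw) (b : ℕ → ℤ) {j : ℕ} (hb : InPolytope b)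
    (hj1 : 1 ≤ j) (hj7 : j ≤ 7) (hb' : InPolytope (shift b j)) (hp5 : 5 ≤ p) (hpb : (p : ℤ) ≤ b 0)
    (hwin : (b 0 + 2 : ℤ) < (p : ℤ) ^ 2) :
    padicNorm p (kRes (shift b j) p * coeffV b - kRes b p * coeffV (shift b j)) ≤ (p : ℚ) ^ (-(refund b p - pairFloors b p)) := by
  have hprime := hp.out
  have hp0 : 0 < p := hprime.pos
  have hr1 : refund b p ≤ 1 := min_le_left _ _
  set T : ℕ → ℕ → ℚ := fun x y => classK (shift b j) p x * classV b p y - classK b p x * classV (shift b j) p y with hT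
  -- the bracket as a double sum over classes
  have hsplit : kRes (shift b j) p * coeffV b - kRes b p * coeffV (shift b j) = ∑ x ∈ range p, ∑ y ∈ range p, T x y := by
    rw [kRes_eq_sum_classK (shift b j) hp0, kRes_eq_sum_classK b hp0, coeffV_eq_sum_classV b hp0, coeffV_eq_sum_classV (shift b j) hp0,
      sum_mul_sum, sum_mul_sum, ← sum_sub_distrib]
    refine sum_congr rfl fun x _ => ?_
    rw [← sum_sub_distrib]
  rw [hsplit, ← sum_filter_add_sum_filter_not (range p) (fun x => 2 ≤ classPoleCount b p x)]
  have hmulti : (range p).filter (fun x => 2 ≤ classPoleCount b p x) = multipoleClasses b p := rfl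
  refine (padicNorm.nonarchimedean (p := p)).trans (max_le ?_ ?_)
  · -- multipole rows: the multipole block and the mixed pairs
    have hinner : ∀ x ∈ multipoleClasses b p, ∑ y ∈ range p, T x y =
        ∑ y ∈ multipoleClasses b p, T x y + ∑ y ∈ (range p).filter (fun y => ¬ 2 ≤ classPoleCount b p y), T x y := fun x _ => by
      rw [← sum_filter_add_sum_filter_not (range p) (fun y => 2 ≤ classPoleCount b p y)]; rfl
    rw [hmulti, sum_congr rfl hinner, sum_add_distrib]
    refine (padicNorm.nonarchimedean (p := p)).trans (max_le ?_ ?_)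
    · exact padicNorm_le_of_val fun hne => hM b j p hb hj1 hj7 hb' hprime hp5 hpb hwin hne
    · refine padicNorm.sum_le' (fun x hx => padicNorm.sum_le' (fun y hy => ?_) (zpow_p_nonneg _)) (zpow_p_nonneg _)
      obtain ⟨hxr, hxm⟩ := mem_filter.1 hx
      obtain ⟨hyr, hy1⟩ := mem_filter.1 hy
      have hx' := mem_range.1 hxr
      have hy' := mem_range.1 hyr
      rcases Nat.eq_zero_or_pos (classPoleCount b p y) with hy0 | hypos
      · have hy0' : classPoleCount (shift b j) p y = 0 := by
          have := classPoleCount_shift_le b hb.1 hj1 p y; omega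
        simp only [hT, classV_eq_zero_of_noPole b hb hy0, classV_eq_zero_of_noPole (shift b j) hb' hy0', mul_zero, sub_zero,
          padicNorm.zero]
        exact zpow_p_nonneg _
      · exact padicNorm_le_of_val fun hne => hX b j p x y hb hj1 hj7 hb' hprime hp5 hpb hwin hx' hy' hxm (by omega) hne
  · -- rows with at most one pole
    refine padicNorm.sum_le' (fun x hx => ?_) (zpow_p_nonneg _)
    obtain ⟨hxr, hxm⟩ := mem_filter.1 hx
    have hx' := mem_range.1 hxr
    have hrow : ∑ y ∈ range p, T x y = classK (shift b j) p x * coeffV b - classK b p x * coeffV (shift b j) := by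
      simp only [hT]
      rw [sum_sub_distrib, ← mul_sum, ← mul_sum, ← coeffV_eq_sum_classV b hp0, ← coeffV_eq_sum_classV (shift b j) hp0]
    rw [hrow]
    rcases Nat.eq_zero_or_pos (classPoleCount b p x) with hx0 | hxpos
    · have hx0' : classPoleCount (shift b j) p x = 0 := by
        have := classPoleCount_shift_le b hb.1 hj1 p x; omega
      rw [classK_eq_zero_of_noPole b hb hx0, classK_eq_zero_of_noPole (shift b j) hb' hx0', zero_mul, zero_mul, sub_zero,
        padicNorm.zero]
      exact zpow_p_nonneg _
    · refine (padicNorm_le_of_val fun hne =>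
        singleRowLaw_holds b j p x hb hj1 hj7 hb' hprime hp5 hwin hx' (by omega) hne).trans (zpow_le_zpow_right₀ one_le_p (by omega))

/-- **(CV) ⇐ `MultiBlockLaw` + `MixedPairLaw`.**  The Casoratian valuation law at every window prime follows from the two block laws
(everything else — the `Ω`-bracket, THEOREM V, the single-pole rows, the primes `p > b₀` — is proved). -/
theorem casoratianValuationLaw_of_blockLaws (hM : MultiBlockLaw) (hX : MixedPairLaw) : CasoratianValuationLaw := by
  intro b j p hb hj1 hj7 hb' hprime hp5 hwin hcas
  haveI : Fact p.Prime := ⟨hprime⟩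
  have hp0 : 0 < p := hprime.pos
  have hp1 : (1 : ℚ) < p := by exact_mod_cast hprime.one_lt
  by_cases hpb : (p : ℤ) ≤ b 0
  swap
  · -- `p > b₀`: no class has two points, `H(3)` holds vacuously
    refine casoratianLaw_of_goodClasses b hb hj1 hj7 hb' hp5 hwin (fun x _ hc2 => ?_) hcas
    exfalso
    obtain ⟨u, hu, v, hv, huv⟩ := one_lt_card.1 (by unfold classPoleCount at hc2; omega :
      1 < ((classSet b p x).filter fun s => netExp b s < 0).card)
    have h0 : 0 ≤ b 0 := hb.1.1
    have := p_le_of_two_mem b hp0 (mem_filter.1 hu).1 (mem_filter.1 hv).1 huv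
    have hb0 : (((b 0).toNat : ℕ) : ℤ) = b 0 := Int.toNat_of_nonneg h0
    omega
  -- `p ≤ b₀`: gen-2 g8's road with the block laws for the `𝒦`-bracket
  have hd0 : 0 ≤ dOf b := by
    have := hb.2.2; unfold dOf; linarith
  have hdshift : dOf (shift b j) = dOf b - 1 := BigPrime.dOf_shift b hj1 hj7
  have hN' : pairFloors (shift b j) p ≤ pairFloors b p := pairFloors_shift_le b hj1 p hp0
  have hwin' : (shift b j 0 + 2 : ℤ) < (p : ℤ) ^ 2 := by rwa [BigPrime.shift_zero b hj1]
  have hVb : padicNorm p (coeffV b) ≤ (p : ℚ) ^ pairFloors b p := padicNorm_coeffV_le_pairFloors b hb hp5 hwin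
  have hVb' : padicNorm p (coeffV (shift b j)) ≤ (p : ℚ) ^ pairFloors b p :=
    (padicNorm_coeffV_le_pairFloors (shift b j) hb' hp5 hwin').trans (zpow_le_zpow_right₀ hp1.le hN')
  have hBb := kBracket_bound_of_blockLaws hM hX b hb hj1 hj7 hb' hp5 hpb hwin
  have hΩint : ∀ b' : ℕ → ℤ, InPolytope b' → padicNorm p (omegaRes b' p) ≤ 1 := fun b' hb'' =>
    padicNorm_omegaRes_le_one b' hb'' (by omega)
  apply val_ge_of_padicNorm_le hcas
  rw [casoratian_split b j p]
  by_cases hpd : (p : ℤ) ≤ dOf b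
  · rw [omegaRes_eq_zero b hb (by omega), omegaRes_eq_zero (shift b j) hb' (by rw [hdshift]; omega), zero_mul, zero_mul,
      sub_zero, zero_sub, padicNorm.neg]
    exact hBb
  · have hr : refund b p = 0 := by
      unfold refund
      rw [Int.ediv_eq_zero_of_lt hd0 (by omega)]; simp
    rw [hr] at hBb
    rw [hr, zero_sub, neg_neg]
    refine (padicNorm.sub (p := p)).trans (max_le ((padicNorm.sub (p := p)).trans (max_le ?_ ?_)) ?_)
    · rw [padicNorm.mul]
      calc padicNorm p (omegaRes (shift b j) p) * padicNorm p (coeffV b) ≤ 1 * (p : ℚ) ^ pairFloors b p :=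
            mul_le_mul (hΩint _ hb') hVb (padicNorm.nonneg _) zero_le_one
        _ = _ := one_mul _
    · rw [padicNorm.mul]
      calc padicNorm p (omegaRes b p) * padicNorm p (coeffV (shift b j)) ≤ 1 * (p : ℚ) ^ pairFloors b p :=
            mul_le_mul (hΩint _ hb) hVb' (padicNorm.nonneg _) zero_le_one
        _ = _ := one_mul _
    · refine hBb.trans (zpow_le_zpow_right₀ hp1.le (by simp))

end Summit.KontsevichZagierPeriods.Zeta5Search.ClusterValuation

end
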